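import Literature.NumberTheory.GelbartRogawski1991.DoubledWeilRepresentationArchLagrangian
import Literature.NumberTheory.GelbartRogawski1991.DoubledUnitarySiegelParabolicAlgebra
import Literature.NumberTheory.GelbartRogawski1991.DoubledUnitaryArchSiegelDiagonalModulus
import Literature.NumberTheory.Automorphic.UnitaryGroupArchSiegelSquares
import Literature.NumberTheory.GelbartRogawski1991.UnitaryDualPairGramDiagonalCM
import Literature.NumberTheory.Weil1964.ArchLiftParabolicValue
import Literature.NumberTheory.Weil1964.AdelicMetaplecticScalarTwist
import HarnessLib

/-!
# The doubled Weil representation, archimedean half (II): a Folland-framed section, twisted by a character matching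
# `χ` on the Siegel parabolic, is an archimedean half with the prescribed parabolic normalisation
([GelbartRogawski1991, §3.1 Prop. 3.1.1 p. 455]: archimedean places of the kernel construction of the compatible
splitting; [Kudla1994, §3]: the Siegel-parabolic character `χ(x(p)) |x(p)|^{1/2}`; [Weil1964, Chap. III n° 46 (42)]:
the value at the origin of an implementer of a Siegel-parabolic element)

Topic `NumberTheory/GelbartRogawski1991`; namespace `Literature.NumberTheory.GelbartRogawski1991.GRConstruction`
(the vocabulary of `DoubledUnitaryGlobalSplittingData`: `gramDA`, `hermD`, `HA`, `IsSiegelDelta`, `detDelta`, `chiDet`,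
`modDelta`, `toSpD`, `projD`, `rDelta`, `opD`, `MpD`, `ParabolicPrescribed`, `IsArchHalf`).  KERNEL only: proved
theorems; no definition, no named fact, no `sorry`.

Setting.  `H(L⁺ ⊗ ℝ) = U(J^𝔻)(L ⊗ ℝ)` (`UnitaryGroup.arch`), the inclusion `jA = (·, 1) : H(L⁺ ⊗ ℝ) →* H(𝔸)` (`hjA`; a variable typed into `H(𝔸)`), `ι^𝔻 ∘ jA : H(L⁺ ⊗ ℝ) → Sp(𝕎^𝔻_𝔸)`, a real frame
`eW : (L⁺ ⊗ ℝ)^{n+n} ≃L[ℝ] ℝ^σ` of `𝕎^𝔻_∞`, and a section `sW : H(L⁺ ⊗ ℝ) →* Mp^𝓢(ℝ^σ)` (Folland's metaplectic group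
realised on `𝓢(ℝ^σ)`) READ in the frame: `archPhaseMap eW (ι^𝔻(g, 1)) = π(sW g)` (`hdict`; `hfin`: `ι^𝔻(g,1)` fixes the
finite vectors).  The tree's `Weil1964.archLift` turns `(eW, sW)` into `sa : H(L⁺ ⊗ ℝ) →* Mp(𝕎^𝔻)ᶜᵒⁿᵗ`,
`g ↦ (ι^𝔻(g,1), (eW^* sW(g) eW_*) ⊗ 1)` (`hsa`).  For a character `η` of `H(L⁺ ⊗ ℝ)` write `sa ⊗ η` for the scalar
twist (`adelicMpCont.twist`).

* §1 `sa ⊗ η` has the three structural fields of `IsArchHalf` (continuity, `π ∘ (sa ⊗ η) = ι^𝔻 ∘ (·,1)`, archimedean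
  operators `(η(g) A_g) ⊗ 1`) for every continuous `η` (`isArchHalf_twist`);
* §2 bookkeeping on `P_Δ(L⁺ ⊗ ℝ)`: the conjugate `r_δ (sa ⊗ η)(g) r_δ⁻¹` is multiplicative and equals
  `(1, η g) · r_δ sa(g) r_δ⁻¹`; the prescribed scalar `χ(det_Δ (g,1)) |det_Δ (g,1)|^{1/2}` is multiplicative and `≠ 0`;
* §3 the `𝕐`-block `d` of `δ ι^𝔻(g,1) δ⁻¹` at `∞` has `0 < det d` and `det d = |det_Δ (g,1)|` (`det_yBlock_eq_det` of
  part (I) with the diagonal action of `DoubledUnitaryArchSiegelDiagonalModulus`);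
* §4 every element of `P_Δ(L⁺ ⊗ ℝ)` is a product of squares of elements of `P_Δ(L⁺ ⊗ ℝ)`
  (`UnitaryGroupArchSiegelSquares`), and two multiplicative scalars on a square-generated set with equal squares agree;
* §5 **`exists_originValue_sq`** — on `P_Δ(L⁺ ⊗ ℝ)` the origin value of `r_δ (sa ⊗ η)(g) r_δ⁻¹` is a scalar `κ_g` with
  `κ_g² = (χ(det_Δ)|det_Δ|^{1/2})²`, PROVIDED `η(g)² · quot(sW g) = χ(det_Δ (g,1))²` (`hη`; `quot` = Folland's quotient
  character of `Mp^𝓢`): Weil's formula for the value at `0` of an implementer of `m(a) n(b)`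
  (`ArchLiftParabolicValue.exists_siegel_of_conj`: `= u · |det a|^{-1/2}`, `u² = quot`) and §3;
* §6 **`parabolicPrescribed_twist`** — hence `κ_g = χ(det_Δ (g,1)) |det_Δ (g,1)|^{1/2}` exactly (§4: both sides are
  multiplicative on `P_Δ(L⁺ ⊗ ℝ)` with equal squares), i.e. `ParabolicPrescribed χ (sa ⊗ η)`; and
  **`isArchHalf_twist_archLift`** — `sa ⊗ η` is an archimedean half `IsArchHalf χ (sa ⊗ η)`.

The sequel `DoubledWeilRepresentationArchHalf` instantiates `(eW, sW)` with Folland's `det^{1/2}`-normalised unitary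
section in the scaled frame (`Weil1964.ArchUnitaryWeilHalf`) and `η = ∏_w det(g_w)^{(e_w+1)/2}`
(`DoubledWeilRepresentationArchTwist`).  Written for the stage-1 cell `pub-hodgecm` (seat GR-3); nothing here is a claim
of the manuscripts adjudicated by that cell.

## References

* S. Gelbart, J. Rogawski, *L-functions and Fourier–Jacobi coefficients for the unitary group U(3)*, Invent. Math. 105
  (1991), §3.1 Prop. 3.1.1 p. 455 [GelbartRogawski1991].
* S. S. Kudla, *Splitting metaplectic covers of dual reductive pairs*, Israel J. Math. 87 (1994) 361–401, §3
  [Kudla1994].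
* A. Weil, *Sur certains groupes d'opérateurs unitaires*, Acta Math. 111 (1964), Chap. III n° 46 (42) p. 202
  [Weil1964].
* G. B. Folland, *Harmonic Analysis in Phase Space*, Princeton UP 1989, §4.2 (4.24), (4.36)–(4.37) [Folland1989].
-/

set_option autoImplicit false

noncomputable section

open scoped Classical
open scoped Matrix Kronecker TensorProduct
open NumberField IsDedekindDomain
open Literature.RepresentationTheory.HeisenbergGroup
open Literature.NumberTheory.Automorphic
open Literature.NumberTheory.Weil1964
open Literature.RepresentationTheory.HarrisKudlaSweet1996
open Literature.NumberTheory.GaloisRepresentations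
open Literature.Analysis.SegalBargmann

namespace Literature.NumberTheory.GelbartRogawski1991.GRConstruction

open UnitaryDualPair

variable (L : Type) [Field L] [NumberField L] [IsCMField L]
variable {N M n : ℕ} (e : Fin N × Fin M ≃ Fin n)
  (dV : Fin N → L) (hdV : ∀ i, IsCMField.complexConj L (dV i) = dV i) (hdV0 : ∀ i, dV i ≠ 0)
  (dW : Fin M → L) (hdW : ∀ i, IsCMField.complexConj L (dW i) = dW i) (hdW0 : ∀ i, dW i ≠ 0)

variable (jA : UnitaryGroup.arch (Fp L) L (IsCMField.complexConj L) (n + n) (hermD L e dV hdV dW hdW) →* HA L e dV hdV dW hdW)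
  (hjA : jA = UnitaryGroup.archToAdelic (Fp L) L (IsCMField.complexConj L) (n + n) (hermD L e dV hdV dW hdW))

variable {σ : Type*} [Fintype σ]
  (eW : (Fin (n + n) → mixedEmbedding.mixedSpace (Fp L)) ≃L[ℝ] (σ → ℝ))
  (sW : UnitaryGroup.arch (Fp L) L (IsCMField.complexConj L) (n + n) (hermD L e dV hdV dW hdW) →* MpS σ)
  (hfin : ∀ (g : UnitaryGroup.arch (Fp L) L (IsCMField.complexConj L) (n + n) (hermD L e dV hdV dW hdW)) (k c : Fin (n + n) → FiniteAdeleRing (𝓞 (Fp L)) (Fp L)),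
    (((toSpD L e dV hdV dW hdW).comp jA) g).1 (finVec k, finVec c) = (finVec k, finVec c))
  (hdict : ∀ g : UnitaryGroup.arch (Fp L) L (IsCMField.complexConj L) (n + n) (hermD L e dV hdV dW hdW),
    archPhaseMap (gramDA L e dV hdV dW hdW) eW (isUnit_archMat_gramDA L e dV hdV hdV0 dW hdW hdW0) (((toSpD L e dV hdV dW hdW).comp jA) g) =
      ⇑((MpS.proj (sW g)).1 : ((σ → ℝ) × (σ → ℝ)) ≃ₗ[ℝ] ((σ → ℝ) × (σ → ℝ))))
  (sa : UnitaryGroup.arch (Fp L) L (IsCMField.complexConj L) (n + n) (hermD L e dV hdV dW hdW) →* MpD L e dV hdV dW hdW)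
  (hsa : sa = archLift (gramDA L e dV hdV dW hdW) eW (isUnit_archMat_gramDA L e dV hdV hdV0 dW hdW hdW0)
        ((toSpD L e dV hdV dW hdW).comp jA) sW hfin hdict)

/-! ## §1 The three structural fields survive any twist -/

section Structural

omit [IsCMField L] in
/-- `c • (A ⊗ 1) = (c • A) ⊗ 1`. [cite: GelbartRogawski1991, §3.1 Prop. 3.1.1 p. 455] -/
theorem smul_adelicTensorEnd_id (c : ℂ) (A : SchwartzMap (Fin (n + n) → mixedEmbedding.mixedSpace (Fp L)) ℂ →ₗ[ℂ] SchwartzMap (Fin (n + n) → mixedEmbedding.mixedSpace (Fp L)) ℂ) :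
    c • adelicTensorEnd A (LinearMap.id : FinSB (Fp L) (Fin (n + n)) →ₗ[ℂ] FinSB (Fp L) (Fin (n + n))) =
      adelicTensorEnd (c • A) LinearMap.id := by
  refine LinearMap.ext fun Ψ => ?_
  obtain ⟨z, rfl⟩ := (piSchwartzBruhatEquiv (Fp L) (Fin (n + n))).surjective Ψ
  induction z using TensorProduct.induction_on with
  | zero => simp only [map_zero]
  | tmul Φ f =>
    rw [LinearMap.smul_apply, adelicTensorEnd_apply_tmul, adelicTensorEnd_apply_tmul, LinearMap.smul_apply,
      ← map_smul, TensorProduct.smul_tmul']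
  | add z₁ z₂ h₁ h₂ => rw [map_add, map_add, map_add, h₁, h₂]

include hsa in
set_option maxHeartbeats 3200000 in
-- (instance unification on `𝓢`/`Mp(𝕎^𝔻)ᶜᵒⁿᵗ` operators is expensive)
/-- **`ω((sa ⊗ η)(g)) = (η(g) A_g) ⊗ 1` is archimedean.** [cite: GelbartRogawski1991, §3.1 Prop. 3.1.1 p. 455] -/
theorem isArch_twist (η : UnitaryGroup.arch (Fp L) L (IsCMField.complexConj L) (n + n) (hermD L e dV hdV dW hdW) →* ℂˣ) (g : UnitaryGroup.arch (Fp L) L (IsCMField.complexConj L) (n + n) (hermD L e dV hdV dW hdW)) :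
    ∃ A : SchwartzMap (Fin (n + n) → mixedEmbedding.mixedSpace (Fp L)) ℂ →L[ℂ] SchwartzMap (Fin (n + n) → mixedEmbedding.mixedSpace (Fp L)) ℂ,
      (adelicMpCont.omega (Fp L) (Fin (n + n)) (gramDA L e dV hdV dW hdW) (adelicMpCont.twist (Fp L) (Fin (n + n)) (gramDA L e dV hdV dW hdW) sa η g) : piSchwartzBruhat (Fp L) (Fin (n + n)) →ₗ[ℂ] piSchwartzBruhat (Fp L) (Fin (n + n))) =
        adelicTensorEnd (A : SchwartzMap (Fin (n + n) → mixedEmbedding.mixedSpace (Fp L)) ℂ →ₗ[ℂ] SchwartzMap (Fin (n + n) → mixedEmbedding.mixedSpace (Fp L)) ℂ) LinearMap.id := by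
  have h1 : (adelicMpCont.omega (Fp L) (Fin (n + n)) (gramDA L e dV hdV dW hdW) (adelicMpCont.twist (Fp L) (Fin (n + n)) (gramDA L e dV hdV dW hdW) sa η g) : piSchwartzBruhat (Fp L) (Fin (n + n)) →ₗ[ℂ] piSchwartzBruhat (Fp L) (Fin (n + n))) =
      ((η g : ℂˣ) : ℂ) • (adelicMpCont.omega (Fp L) (Fin (n + n)) (gramDA L e dV hdV dW hdW) (sa g) : piSchwartzBruhat (Fp L) (Fin (n + n)) →ₗ[ℂ] piSchwartzBruhat (Fp L) (Fin (n + n))) :=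
    LinearMap.ext fun Ψ => by
      rw [LinearMap.smul_apply]
      exact adelicMpCont.omega_twist sa η g Ψ
  subst hsa
  obtain ⟨A, hA⟩ := isArch_archLift (gramDA L e dV hdV dW hdW) eW (isUnit_archMat_gramDA L e dV hdV hdV0 dW hdW hdW0)
    ((toSpD L e dV hdV dW hdW).comp jA) sW hfin hdict g
  refine ⟨((η g : ℂˣ) : ℂ) • A, ?_⟩
  rw [h1, hA, smul_adelicTensorEnd_id, ContinuousLinearMap.toLinearMap_smul]

include hsa hjA in
set_option maxHeartbeats 800000 in
/-- **the three structural fields survive any twist**: for every continuous character `η` of `H(L⁺ ⊗ ℝ)` with the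
parabolic prescription, `sa ⊗ η` is an archimedean half. [cite: GelbartRogawski1991, §3.1 Prop. 3.1.1 p. 455] -/
theorem isArchHalf_twist (χ : HeckeCharacter L) (hcont : Continuous sa) (η : UnitaryGroup.arch (Fp L) L (IsCMField.complexConj L) (n + n) (hermD L e dV hdV dW hdW) →* ℂˣ)
    (hηc : Continuous fun g => ((η g : ℂˣ) : ℂ))
    (hpar : ParabolicPrescribed L e dV hdV hdV0 dW hdW hdW0 jA χ (adelicMpCont.twist (Fp L) (Fin (n + n)) (gramDA L e dV hdV dW hdW) sa η)) :
    IsArchHalf L e dV hdV hdV0 dW hdW hdW0 χ (adelicMpCont.twist (Fp L) (Fin (n + n)) (gramDA L e dV hdV dW hdW) sa η) where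
  continuous := adelicMpCont.continuous_twist sa η hcont hηc
  proj_eq g := by
    subst hjA hsa
    exact (adelicMpCont.proj_twist _ _ g).trans rfl
  isArch g := isArch_twist L e dV hdV hdV0 dW hdW hdW0 jA eW sW hfin hdict sa hsa η g
  parabolic := by
    subst hjA
    exact hpar

end Structural

/-! ## §2 Bookkeeping on `P_Δ(L⁺ ⊗ ℝ)`: the conjugated twist and the prescribed scalar -/

section Prescribed

omit [Field L] [NumberField L] [IsCMField L] in
/-- `r (x y) r⁻¹ = (r x r⁻¹)(r y r⁻¹)`. [cite: GelbartRogawski1991, §3.1 Prop. 3.1.1 p. 455] -/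
theorem conj_mul_general {G : Type*} [Group G] (r x y : G) : r * (x * y) * r⁻¹ = r * x * r⁻¹ * (r * y * r⁻¹) := by
  group

omit [Field L] [NumberField L] [IsCMField L] in
/-- `r (o x) r⁻¹ = o (r x r⁻¹)` for `o` commuting with `r`. [cite: GelbartRogawski1991, §3.1 Prop. 3.1.1 p. 455] -/
theorem conj_central_general {G : Type*} [Group G] (r o x : G) (hc : r * o = o * r) :
    r * (o * x) * r⁻¹ = o * (r * x * r⁻¹) := by
  rw [← mul_assoc r o x, hc]; group

set_option maxHeartbeats 800000 in
/-- `g ↦ r_δ (sa ⊗ η)(g) r_δ⁻¹` is multiplicative. [cite: GelbartRogawski1991, §3.1 Prop. 3.1.1 p. 455] -/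
theorem conj_twist_mul (η : UnitaryGroup.arch (Fp L) L (IsCMField.complexConj L) (n + n) (hermD L e dV hdV dW hdW) →* ℂˣ) (p q : UnitaryGroup.arch (Fp L) L (IsCMField.complexConj L) (n + n) (hermD L e dV hdV dW hdW)) :
    (rDelta L e dV hdV hdV0 dW hdW hdW0 * adelicMpCont.twist (Fp L) (Fin (n + n)) (gramDA L e dV hdV dW hdW) sa η (p * q) * (rDelta L e dV hdV hdV0 dW hdW hdW0)⁻¹) =
      (rDelta L e dV hdV hdV0 dW hdW hdW0 * adelicMpCont.twist (Fp L) (Fin (n + n)) (gramDA L e dV hdV dW hdW) sa η p * (rDelta L e dV hdV hdV0 dW hdW hdW0)⁻¹) *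
        (rDelta L e dV hdV hdV0 dW hdW hdW0 * adelicMpCont.twist (Fp L) (Fin (n + n)) (gramDA L e dV hdV dW hdW) sa η q * (rDelta L e dV hdV hdV0 dW hdW hdW0)⁻¹) :=
  (congrArg (fun t => rDelta L e dV hdV hdV0 dW hdW hdW0 * t * (rDelta L e dV hdV hdV0 dW hdW hdW0)⁻¹) ((adelicMpCont.twist (Fp L) (Fin (n + n)) (gramDA L e dV hdV dW hdW) sa η).map_mul p q)).trans (conj_mul_general _ _ _)

set_option maxHeartbeats 800000 in
/-- `r_δ (sa ⊗ η)(g) r_δ⁻¹ = (1, η g) · (r_δ sa(g) r_δ⁻¹)`. [cite: GelbartRogawski1991, §3.1 Prop. 3.1.1 p. 455] -/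
theorem conj_twist_eq (η : UnitaryGroup.arch (Fp L) L (IsCMField.complexConj L) (n + n) (hermD L e dV hdV dW hdW) →* ℂˣ) (g : UnitaryGroup.arch (Fp L) L (IsCMField.complexConj L) (n + n) (hermD L e dV hdV dW hdW)) :
    (rDelta L e dV hdV hdV0 dW hdW hdW0 * adelicMpCont.twist (Fp L) (Fin (n + n)) (gramDA L e dV hdV dW hdW) sa η g * (rDelta L e dV hdV hdV0 dW hdW hdW0)⁻¹) =
      adelicMpCont.ofScalar (Fp L) (Fin (n + n)) (gramDA L e dV hdV dW hdW) (η g) * (rDelta L e dV hdV hdV0 dW hdW hdW0 * sa g * (rDelta L e dV hdV hdV0 dW hdW hdW0)⁻¹) :=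
  (congrArg (fun t => rDelta L e dV hdV hdV0 dW hdW hdW0 * t * (rDelta L e dV hdV hdV0 dW hdW hdW0)⁻¹) (adelicMpCont.twist_apply sa η g)).trans
    (conj_central_general _ _ _ (adelicMpCont.mul_ofScalar_comm (η g) (rDelta L e dV hdV hdV0 dW hdW hdW0)))

/-- `|det_Δ p|^{1/2} ≠ 0`. [cite: Kudla1994, §3] -/
theorem modDelta_ne_zero (p : HA L e dV hdV dW hdW) : modDelta L e dV hdV dW hdW p ≠ 0 := by
  unfold modDelta
  split_ifs with hu
  · rw [← coe_ideleNorm]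
    exact Real.sqrt_ne_zero'.2 (NNReal.coe_pos.2 (pos_iff_ne_zero.2 (ideleNorm_ne_zero _)))
  · exact one_ne_zero

/-- the prescribed scalar `χ(det_Δ (g,1)) |det_Δ (g,1)|^{1/2}` is multiplicative on `P_Δ(L⁺ ⊗ ℝ)`. [cite: Kudla1994, §3] -/
theorem prescribed_mul (χ : HeckeCharacter L) {p q : UnitaryGroup.arch (Fp L) L (IsCMField.complexConj L) (n + n) (hermD L e dV hdV dW hdW)}
    (hp : IsSiegelDelta L e dV hdV dW hdW (jA p)) (hq : IsSiegelDelta L e dV hdV dW hdW (jA q)) :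
    (((chiDet L e dV hdV dW hdW χ (jA (p * q)) : ℂˣ) : ℂ) *
          (modDelta L e dV hdV dW hdW (jA (p * q)) : ℂ)) =
      (((chiDet L e dV hdV dW hdW χ (jA p) : ℂˣ) : ℂ) *
          (modDelta L e dV hdV dW hdW (jA p) : ℂ)) *
        (((chiDet L e dV hdV dW hdW χ (jA q) : ℂˣ) : ℂ) *
          (modDelta L e dV hdV dW hdW (jA q) : ℂ)) := by
  rw [map_mul, chiDet_mul L e dV hdV dW hdW χ hp hq, modDelta_mul L e dV hdV dW hdW hp hq, Units.val_mul, Complex.ofReal_mul]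
  ring

/-- the prescribed scalar is `≠ 0`. [cite: Kudla1994, §3] -/
theorem prescribed_ne_zero (χ : HeckeCharacter L) (p : UnitaryGroup.arch (Fp L) L (IsCMField.complexConj L) (n + n) (hermD L e dV hdV dW hdW)) :
    (((chiDet L e dV hdV dW hdW χ (jA p) : ℂˣ) : ℂ) *
          (modDelta L e dV hdV dW hdW (jA p) : ℂ)) ≠ 0 :=
  mul_ne_zero (Units.ne_zero _) (Complex.ofReal_ne_zero.2 (modDelta_ne_zero L e dV hdV dW hdW _))

end Prescribed

/-! ## §3 The `𝕐`-block of `δ ι^𝔻(g,1) δ⁻¹` at `∞`: `0 < det d = |det_Δ (g,1)|` -/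

section Modulus

variable [DecidableEq σ]

include hdV0 hdW0 hjA in
/-- **the modulus**: for `g ∈ P_Δ(L⁺ ⊗ ℝ)` the `𝕐`-block `d` of `δ ι^𝔻(g,1) δ⁻¹` at `∞` (in any real frame `eW`) has
`0 < det d` and `det d = (modDelta (g,1))² = |det_Δ (g,1)|_{𝔸_L}` (`d = ψ A ψ⁻¹` for the diagonal action `A` of
`ι^𝔻(g,1)`, `det A = ∏_w |det α_w|²`). [cite: Kudla1994, §3] -/
theorem det_yBlock_pos_and_eq_modDelta_sq (g : UnitaryGroup.arch (Fp L) L (IsCMField.complexConj L) (n + n) (hermD L e dV hdV dW hdW))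
    (hS : IsSiegelDelta L e dV hdV dW hdW (jA g))
    (d : (σ → ℝ) ≃ₗ[ℝ] (σ → ℝ))
    (hd : ∀ y, d y = (archPhaseMap (gramDA L e dV hdV dW hdW) eW (isUnit_archMat_gramDA L e dV hdV hdV0 dW hdW hdW0)
      (ratSp (Fp L) (gramDA L e dV hdV dW hdW) (isUnit_det_gramDA L e dV hdV hdV0 dW hdW hdW0) (deltaD L) * ((toSpD L e dV hdV dW hdW).comp jA) g *
        (ratSp (Fp L) (gramDA L e dV hdV dW hdW) (isUnit_det_gramDA L e dV hdV hdV0 dW hdW hdW0) (deltaD L))⁻¹) (0, y)).2) :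
    0 < LinearMap.det (d : (σ → ℝ) →ₗ[ℝ] (σ → ℝ)) ∧
      ((LinearMap.det (d : (σ → ℝ) →ₗ[ℝ] (σ → ℝ)) : ℝ) : ℂ) =
        ((modDelta L e dV hdV dW hdW (jA g) : ℝ) : ℂ) ^ 2 := by
  subst hjA
  obtain ⟨A, hA, hpos, hsq⟩ := exists_archAct_diagPair_det_eq_modDelta_sq L e dV hdV dW hdW g hS
    (isUnit_detDelta_of_isSiegelDelta L e dV hdV dW hdW _ hS)
  rw [det_yBlock_eq_det L e dV hdV hdV0 dW hdW hdW0 eW _ A (fun az => hA az) d hd]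
  exact ⟨hpos, hsq⟩

end Modulus

/-! ## §4 `P_Δ(L⁺ ⊗ ℝ)` is generated by squares; multiplicative scalars with equal squares agree -/

section Squares

include hdV0 hdW0 hjA in
/-- **every element of `P_Δ(L⁺ ⊗ ℝ) ≅ ∏_w GL_n(ℂ) ⋉ Herm_n` is a product of squares of elements of `P_Δ(L⁺ ⊗ ℝ)`**
(the tree's `UnitaryGroup.exists_list_sq_of_isSiegel_archToAdelic_of_base` at `J^𝔻 = e₂ (T ⊕ −T) e₂ ⊗ L`,
`T = gramR` symmetric with unit determinant). [cite: Kudla1994, §3] -/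
theorem exists_list_sq_of_isSiegelDelta_arch (p : UnitaryGroup.arch (Fp L) L (IsCMField.complexConj L) (n + n) (hermD L e dV hdV dW hdW))
    (hp : IsSiegelDelta L e dV hdV dW hdW (jA p)) :
    ∃ l : List (UnitaryGroup.arch (Fp L) L (IsCMField.complexConj L) (n + n) (hermD L e dV hdV dW hdW)),
      (∀ q ∈ l, IsSiegelDelta L e dV hdV dW hdW (jA q)) ∧ p = (l.map fun q => q * q).prod := by
  subst hjA
  exact UnitaryGroup.exists_list_sq_of_isSiegel_archToAdelic_of_base (Fp L) L (IsCMField.complexConj L) (n + n)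
    (hermD L e dV hdV dW hdW) (e₂ (n := n)) (fun x => IsCMField.complexConj_apply_apply L x)
    (T := gramR L e dV hdV dW hdW) (by unfold gramR; rw [gram_realDiagonal]; exact Matrix.diagonal_transpose _)
    (isUnit_det_gramR₀ L e dV hdV hdV0 dW hdW hdW0) rfl p hp

omit [Field L] [NumberField L] [IsCMField L] in
/-- **two multiplicative scalars on a multiplicatively closed, square-generated set with equal squares agree**
(the sign of the origin value is fixed on squares). [cite: GelbartRogawski1991, §3.1 Prop. 3.1.1 p. 455] -/
theorem eq_of_sq_eq_of_prod_squares {G : Type*} [Group G] (S : Set G) (hS1 : (1 : G) ∈ S)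
    (hSmul : ∀ p ∈ S, ∀ q ∈ S, p * q ∈ S) (c τ : G → ℂ)
    (hc : ∀ p ∈ S, ∀ q ∈ S, c (p * q) = c p * c q) (hτ : ∀ p ∈ S, ∀ q ∈ S, τ (p * q) = τ p * τ q)
    (hτ0 : ∀ p ∈ S, τ p ≠ 0) (hsq : ∀ p ∈ S, c p ^ 2 = τ p ^ 2)
    (hgen : ∀ p ∈ S, ∃ l : List G, (∀ q ∈ l, q ∈ S) ∧ p = (l.map fun q => q * q).prod) :
    ∀ p ∈ S, c p = τ p := by
  -- on squares: `c (q q) = c q ² = τ q ² = τ (q q)`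
  have hsqr : ∀ q ∈ S, c (q * q) = τ (q * q) := fun q hq => by
    rw [hc q hq q hq, hτ q hq q hq, ← sq, ← sq, hsq q hq]
  -- products of squares, by induction on the list (keeping the partial products in `S`)
  have key : ∀ l : List G, (∀ q ∈ l, q ∈ S) →
      (l.map fun q => q * q).prod ∈ S ∧ c (l.map fun q => q * q).prod = τ (l.map fun q => q * q).prod := by
    intro l
    induction l with
    | nil =>
      intro _
      refine ⟨by simpa using hS1, ?_⟩
      simp only [List.map_nil, List.prod_nil]
      have hc1 : c 1 * c 1 = c 1 := by rw [← hc 1 hS1 1 hS1, one_mul]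
      have hτ1 : τ 1 = 1 := by
        have h := hτ 1 hS1 1 hS1
        rw [one_mul] at h
        exact (mul_right_eq_self₀.1 h.symm).resolve_right (hτ0 1 hS1)
      have hc1' : c 1 = 0 ∨ c 1 = 1 := by
        rcases eq_or_ne (c 1) 0 with h | h
        · exact Or.inl h
        · exact Or.inr (mul_right_eq_self₀.1 hc1 |>.resolve_right h)
      rcases hc1' with h | h
      · have := hsq 1 hS1
        rw [h, hτ1] at this
        norm_num at this
      · rw [h, hτ1]
    | cons q l ih =>
      intro hl
      have hq : q ∈ S := hl q (by simp)
      have hl' : ∀ q' ∈ l, q' ∈ S := fun q' hq' => hl q' (by simp [hq'])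
      obtain ⟨hmem, heq⟩ := ih hl'
      refine ⟨?_, ?_⟩
      · simp only [List.map_cons, List.prod_cons]
        exact hSmul _ (hSmul q hq q hq) _ hmem
      · simp only [List.map_cons, List.prod_cons]
        rw [hc _ (hSmul q hq q hq) _ hmem, hτ _ (hSmul q hq q hq) _ hmem, hsqr q hq, heq]
  intro p hp
  obtain ⟨l, hl, rfl⟩ := hgen p hp
  exact (key l hl).2

end Squares

/-! ## §5 The origin value of `r_δ (sa ⊗ η)(g) r_δ⁻¹` on `P_Δ(L⁺ ⊗ ℝ)` -/

section Origin

variable [DecidableEq σ]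

include hsa hjA in
set_option maxHeartbeats 3200000 in
-- (the origin-value computation elaborates many `Mp(𝕎^𝔻)ᶜᵒⁿᵗ`/`𝓢` terms; instance unification is expensive)
/-- **the origin value of `r_δ (sa ⊗ η)(g) r_δ⁻¹` on `P_Δ(L⁺ ⊗ ℝ)`** is a scalar whose square is the square of the
prescribed one: `∃ κ, (ω(…)Φ)(0) = κ Φ(0) ∀ Φ` and `κ² = (χ(det_Δ (g,1)) |det_Δ (g,1)|^{1/2})²`, provided
`η(g)² · quot(sW g) = χ(det_Δ (g,1))²` (Weil's value at the origin `u · |det a|^{-1/2}` of an implementer of `m(a) n(b)`,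
`u² = quot`, and §3). [cite: Weil1964, Chap. III n° 46 (42) p. 202] -/
theorem exists_originValue_sq (χ : HeckeCharacter L) (η : UnitaryGroup.arch (Fp L) L (IsCMField.complexConj L) (n + n) (hermD L e dV hdV dW hdW) →* ℂˣ)
    (hη : ∀ g : UnitaryGroup.arch (Fp L) L (IsCMField.complexConj L) (n + n) (hermD L e dV hdV dW hdW), IsSiegelDelta L e dV hdV dW hdW (jA g) →
      ((η g : ℂˣ) : ℂ) ^ 2 * MpS.quot (sW g) = ((chiDet L e dV hdV dW hdW χ (jA g) : ℂˣ) : ℂ) ^ 2)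
    (A : SchwartzMap (Fin (n + n) → mixedEmbedding.mixedSpace (Fp L)) ℂ ≃L[ℂ] SchwartzMap (Fin (n + n) → mixedEmbedding.mixedSpace (Fp L)) ℂ) (P : FinSB (Fp L) (Fin (n + n)) ≃ₗ[ℂ] FinSB (Fp L) (Fin (n + n)))
    (hr : ∀ (Φ : SchwartzMap (Fin (n + n) → mixedEmbedding.mixedSpace (Fp L)) ℂ) (f : FinSB (Fp L) (Fin (n + n))),
      adelicMpCont.omega (Fp L) (Fin (n + n)) (gramDA L e dV hdV dW hdW) (rDelta L e dV hdV hdV0 dW hdW hdW0) (piSchwartzBruhatEquiv (Fp L) (Fin (n + n)) (Φ ⊗ₜ f)) =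
        piSchwartzBruhatEquiv (Fp L) (Fin (n + n)) (A Φ ⊗ₜ P f))
    (z : MpS σ)
    (hz' : (⇑((MpS.proj z).1 : ((σ → ℝ) × (σ → ℝ)) ≃ₗ[ℝ] ((σ → ℝ) × (σ → ℝ))) : ((σ → ℝ) × (σ → ℝ)) → ((σ → ℝ) × (σ → ℝ))) =
      archPhaseMap (gramDA L e dV hdV dW hdW) eW (isUnit_archMat_gramDA L e dV hdV hdV0 dW hdW hdW0) (adelicMpCont.proj (Fp L) (Fin (n + n)) (gramDA L e dV hdV dW hdW) (rDelta L e dV hdV hdV0 dW hdW hdW0)))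
    (g : UnitaryGroup.arch (Fp L) L (IsCMField.complexConj L) (n + n) (hermD L e dV hdV dW hdW)) (hS : IsSiegelDelta L e dV hdV dW hdW (jA g)) :
    ∃ κ : ℂ, (∀ Φ, opD L e dV hdV dW hdW (rDelta L e dV hdV hdV0 dW hdW hdW0 * adelicMpCont.twist (Fp L) (Fin (n + n)) (gramDA L e dV hdV dW hdW) sa η g * (rDelta L e dV hdV hdV0 dW hdW hdW0)⁻¹) Φ 0 =
        κ * (Φ : (Fin (n + n) → AdeleRing (𝓞 (Fp L)) (Fp L)) → ℂ) 0) ∧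
      κ ^ 2 = ((((chiDet L e dV hdV dW hdW χ (jA g) : ℂˣ) : ℂ) *
          (modDelta L e dV hdV dW hdW (jA g) : ℂ))) ^ 2 := by
  have hπr : adelicMpCont.proj (Fp L) (Fin (n + n)) (gramDA L e dV hdV dW hdW) (rDelta L e dV hdV hdV0 dW hdW hdW0) =
      ratSp (Fp L) (gramDA L e dV hdV dW hdW) (isUnit_det_gramDA L e dV hdV hdV0 dW hdW hdW0) (deltaD L) :=
    projD_rDelta L e dV hdV hdV0 dW hdW hdW0
  have hSi : IsSiegelDelta L e dV hdV dW hdW (jA g⁻¹) := by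
    rw [map_inv]; exact isSiegelDelta_inv L e dV hdV dW hdW hS
  have hq : ∀ y : Fin (n + n) → AdeleRing (𝓞 (Fp L)) (Fp L),
      ((adelicMpCont.proj (Fp L) (Fin (n + n)) (gramDA L e dV hdV dW hdW) (rDelta L e dV hdV hdV0 dW hdW hdW0) * ((toSpD L e dV hdV dW hdW).comp jA) g *
          (adelicMpCont.proj (Fp L) (Fin (n + n)) (gramDA L e dV hdV dW hdW) (rDelta L e dV hdV hdV0 dW hdW hdW0))⁻¹).1 (0, y)).1 = 0 := by
    intro y; rw [hπr]; exact conj_deltaD_toSpD_apply_zero_fst L e dV hdV hdV0 dW hdW hdW0 _ hS y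
  have hq' : ∀ y : Fin (n + n) → AdeleRing (𝓞 (Fp L)) (Fp L),
      ((adelicMpCont.proj (Fp L) (Fin (n + n)) (gramDA L e dV hdV dW hdW) (rDelta L e dV hdV hdV0 dW hdW hdW0) * ((toSpD L e dV hdV dW hdW).comp jA) g *
          (adelicMpCont.proj (Fp L) (Fin (n + n)) (gramDA L e dV hdV dW hdW) (rDelta L e dV hdV hdV0 dW hdW hdW0))⁻¹)⁻¹.1 (0, y)).1 = 0 := by
    intro y
    have hinv : (adelicMpCont.proj (Fp L) (Fin (n + n)) (gramDA L e dV hdV dW hdW) (rDelta L e dV hdV hdV0 dW hdW hdW0) * ((toSpD L e dV hdV dW hdW).comp jA) g *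
          (adelicMpCont.proj (Fp L) (Fin (n + n)) (gramDA L e dV hdV dW hdW) (rDelta L e dV hdV hdV0 dW hdW hdW0))⁻¹)⁻¹ =
        ratSp (Fp L) (gramDA L e dV hdV dW hdW) (isUnit_det_gramDA L e dV hdV hdV0 dW hdW hdW0) (deltaD L) * toSpD L e dV hdV dW hdW (jA g⁻¹) *
          (ratSp (Fp L) (gramDA L e dV hdV dW hdW) (isUnit_det_gramDA L e dV hdV hdV0 dW hdW hdW0) (deltaD L))⁻¹ := by
      rw [hπr]
      show (_ * toSpD L e dV hdV dW hdW (jA g) * _)⁻¹ = _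
      rw [map_inv jA g, map_inv (toSpD L e dV hdV dW hdW)]
      group
    rw [hinv]; exact conj_deltaD_toSpD_apply_zero_fst L e dV hdV hdV0 dW hdW hdW0 _ hSi y
  obtain ⟨a, d, had, b, hb, u, hu, hdec, -, hwu, hval⟩ :=
    exists_siegel_of_conj (gramDA L e dV hdV dW hdW) eW (isUnit_archMat_gramDA L e dV hdV hdV0 dW hdW hdW0) ((toSpD L e dV hdV dW hdW).comp jA) sW hdict (rDelta L e dV hdV hdV0 dW hdW hdW0) z hz' g hq hq'
  have hdy : ∀ y, d y = (archPhaseMap (gramDA L e dV hdV dW hdW) eW (isUnit_archMat_gramDA L e dV hdV hdV0 dW hdW hdW0)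
      (ratSp (Fp L) (gramDA L e dV hdV dW hdW) (isUnit_det_gramDA L e dV hdV hdV0 dW hdW hdW0) (deltaD L) * ((toSpD L e dV hdV dW hdW).comp jA) g *
        (ratSp (Fp L) (gramDA L e dV hdV dW hdW) (isUnit_det_gramDA L e dV hdV hdV0 dW hdW hdW0) (deltaD L))⁻¹) (0, y)).2 := by
    intro y
    rw [levi_snd_eq_archPhaseMap (gramDA L e dV hdV dW hdW) eW (isUnit_archMat_gramDA L e dV hdV hdV0 dW hdW hdW0) ((toSpD L e dV hdV dW hdW).comp jA) sW hdict (rDelta L e dV hdV hdV0 dW hdW hdW0) z hz' g hdec y, hπr]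
  obtain ⟨hdetd, hmodd⟩ := det_yBlock_pos_and_eq_modDelta_sq L e dV hdV hdV0 dW hdW hdW0 jA hjA eW g hS d hdy
  have hdet : 0 < LinearMap.det (a : (σ → ℝ) →ₗ[ℝ] (σ → ℝ)) := (det_pos_iff_of_dual a d had).2 hdetd
  have hmod : leviFactor a ^ 2 = ((modDelta L e dV hdV dW hdW (jA g) : ℝ) : ℂ) ^ 2 :=
    (leviFactor_sq_eq_det a d had hdetd).trans hmodd
  have hu2 : u ^ 2 = MpS.quot (sW g) := sq_originValue_eq_quot sW z g hdet hwu
  -- the origin value of the untwisted conjugate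
  subst hsa
  have h0 : ∀ Ψ : piSchwartzBruhat (Fp L) (Fin (n + n)),
      ((adelicMpCont.omega (Fp L) (Fin (n + n)) (gramDA L e dV hdV dW hdW)
          (rDelta L e dV hdV hdV0 dW hdW hdW0 * archLift (gramDA L e dV hdV dW hdW) eW (isUnit_archMat_gramDA L e dV hdV hdV0 dW hdW hdW0)
        ((toSpD L e dV hdV dW hdW).comp jA) sW hfin hdict g *
            (rDelta L e dV hdV hdV0 dW hdW hdW0)⁻¹) Ψ : piSchwartzBruhat (Fp L) (Fin (n + n))) : (Fin (n + n) → AdeleRing (𝓞 (Fp L)) (Fp L)) → ℂ) 0 =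
        (u * leviFactor a) * (Ψ : (Fin (n + n) → AdeleRing (𝓞 (Fp L)) (Fp L)) → ℂ) 0 :=
    fun Ψ => omega_conj_archLift_apply_zero (gramDA L e dV hdV dW hdW) eW (isUnit_archMat_gramDA L e dV hdV hdV0 dW hdW hdW0) ((toSpD L e dV hdV dW hdW).comp jA) sW hfin hdict (rDelta L e dV hdV hdV0 dW hdW hdW0) A P hr z hz' g hval Ψ
  refine ⟨((η g : ℂˣ) : ℂ) * (u * leviFactor a), fun Φ => ?_, ?_⟩
  · rw [conj_twist_eq, opD_mul]
    simp only [opD, adelicMpCont.omega_ofScalar, Submodule.coe_smul, Pi.smul_apply, smul_eq_mul]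
    rw [h0]
    ring
  · rw [mul_pow, mul_pow, hu2, ← mul_assoc, hη g hS, hmod, ← mul_pow]

end Origin

/-! ## §6 The parabolic prescription and the archimedean half -/

section Parabolic

variable [DecidableEq σ]

include hsa hjA in
set_option maxHeartbeats 1600000 in
-- (the assembly elaborates many `Mp(𝕎^𝔻)ᶜᵒⁿᵗ`/`𝓢` terms; instance unification is expensive)
/-- **`sa ⊗ η` has the prescribed origin values `χ(det_Δ (g,1)) |det_Δ (g,1)|^{1/2}` on `P_Δ(L⁺ ⊗ ℝ)`** whenever
`η(g)² · quot(sW g) = χ(det_Δ (g,1))²` there: the origin value of `r_δ (sa ⊗ η)(g) r_δ⁻¹` is a multiplicative scalar on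
`P_Δ(L⁺ ⊗ ℝ)` (§5) with the square of the prescribed (multiplicative, non-vanishing) one, and `P_Δ(L⁺ ⊗ ℝ)` is
generated by squares (§4). [cite: GelbartRogawski1991, §3.1 Prop. 3.1.1 p. 455] -/
theorem parabolicPrescribed_twist (χ : HeckeCharacter L) (η : UnitaryGroup.arch (Fp L) L (IsCMField.complexConj L) (n + n) (hermD L e dV hdV dW hdW) →* ℂˣ)
    (hη : ∀ g : UnitaryGroup.arch (Fp L) L (IsCMField.complexConj L) (n + n) (hermD L e dV hdV dW hdW), IsSiegelDelta L e dV hdV dW hdW (jA g) →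
      ((η g : ℂˣ) : ℂ) ^ 2 * MpS.quot (sW g) = ((chiDet L e dV hdV dW hdW χ (jA g) : ℂˣ) : ℂ) ^ 2) :
    ParabolicPrescribed L e dV hdV hdV0 dW hdW hdW0 jA χ (adelicMpCont.twist (Fp L) (Fin (n + n)) (gramDA L e dV hdV dW hdW) sa η) := by
  -- (1) the tensor form of `ω(r_F^𝔻(δ))` and a metaplectic reading `z` of `δ_∞`
  obtain ⟨A, P, hr⟩ := exists_omega_tmul (gramDA L e dV hdV dW hdW)
    (mulVec_surjective_of_isUnit_det (Fp L) (gramDA L e dV hdV dW hdW) (isUnit_det_gramDA L e dV hdV hdV0 dW hdW hdW0)) (rDelta L e dV hdV hdV0 dW hdW hdW0)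
  obtain ⟨z, hz⟩ := exists_MpS_over_archPhaseMap (gramDA L e dV hdV dW hdW) eW (isUnit_archMat_gramDA L e dV hdV hdV0 dW hdW hdW0)
    (ratSp (Fp L) (gramDA L e dV hdV dW hdW) (isUnit_det_gramDA L e dV hdV hdV0 dW hdW hdW0) (deltaD L))
  have hπr : adelicMpCont.proj (Fp L) (Fin (n + n)) (gramDA L e dV hdV dW hdW) (rDelta L e dV hdV hdV0 dW hdW hdW0) =
      ratSp (Fp L) (gramDA L e dV hdV dW hdW) (isUnit_det_gramDA L e dV hdV hdV0 dW hdW hdW0) (deltaD L) :=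
    projD_rDelta L e dV hdV hdV0 dW hdW hdW0
  have hz' : (⇑((MpS.proj z).1 : ((σ → ℝ) × (σ → ℝ)) ≃ₗ[ℝ] ((σ → ℝ) × (σ → ℝ))) : ((σ → ℝ) × (σ → ℝ)) → ((σ → ℝ) × (σ → ℝ))) =
      archPhaseMap (gramDA L e dV hdV dW hdW) eW (isUnit_archMat_gramDA L e dV hdV hdV0 dW hdW hdW0) (adelicMpCont.proj (Fp L) (Fin (n + n)) (gramDA L e dV hdV dW hdW) (rDelta L e dV hdV hdV0 dW hdW hdW0)) := by
    rw [hπr]; exact hz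
  have horig := fun g hS =>
    exists_originValue_sq L e dV hdV hdV0 dW hdW hdW0 jA hjA eW sW hfin hdict sa hsa χ η hη A P hr z hz' g hS
  -- (2) the origin-value scalar `c` on `P_Δ(L⁺ ⊗ ℝ)` and its multiplicativity
  obtain ⟨Φ₀, hΦ₀⟩ : ∃ Φ : piSchwartzBruhat (Fp L) (Fin (n + n)),
      (Φ : (Fin (n + n) → AdeleRing (𝓞 (Fp L)) (Fp L)) → ℂ) 0 ≠ 0 := by
    -- the pure tensor `unitSchwartz ⊗ 𝟙_{𝒪̂^{n+n}}`
    refine ⟨piSchwartzBruhatEquiv (Fp L) (Fin (n + n)) (unitSchwartz (Fp L) (Fin (n + n)) ⊗ₜ[ℂ]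
      indicatorSB (Fp L) (Fin (n + n)) (piLevelIdeal (Fp L) (Fin (n + n)) ⊤) (isOpen_piLevelIdeal (Fp L) ⊤)
        (isCompact_piLevelIdeal (Fp L) (Fin (n + n)) ⊤)), ?_⟩
    rw [coe_piSchwartzBruhatEquiv_tmul]
    have h0 : piArch (Fp L) (Fin (n + n)) 0 = 0 := by
      funext i
      rw [piArch_apply, Pi.zero_apply]
      exact map_zero (InfiniteAdeleRing.ringEquiv_mixedSpace (Fp L))
    have h1 : piFinite (Fp L) (Fin (n + n)) 0 = 0 := rfl
    simp only [h0, h1, unitSchwartz_apply_zero, one_mul, coe_indicatorSB]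
    rw [Set.indicator_of_mem (show (0 : Fin (n + n) → FiniteAdeleRing (𝓞 (Fp L)) (Fp L)) ∈
      (piLevelIdeal (Fp L) (Fin (n + n)) ⊤ : Set _) from (piLevelIdeal (Fp L) (Fin (n + n)) ⊤).zero_mem)]
    exact one_ne_zero
  let S : Set (UnitaryGroup.arch (Fp L) L (IsCMField.complexConj L) (n + n) (hermD L e dV hdV dW hdW)) := {g | IsSiegelDelta L e dV hdV dW hdW (jA g)}
  let c : UnitaryGroup.arch (Fp L) L (IsCMField.complexConj L) (n + n) (hermD L e dV hdV dW hdW) → ℂ := fun g =>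
    if h : IsSiegelDelta L e dV hdV dW hdW (jA g) then Classical.choose (horig g h) else 1
  let τ : UnitaryGroup.arch (Fp L) L (IsCMField.complexConj L) (n + n) (hermD L e dV hdV dW hdW) → ℂ := fun g =>
    (((chiDet L e dV hdV dW hdW χ (jA g) : ℂˣ) : ℂ) *
          (modDelta L e dV hdV dW hdW (jA g) : ℂ))
  have hcval : ∀ g ∈ S, ∀ Φ, opD L e dV hdV dW hdW (rDelta L e dV hdV hdV0 dW hdW hdW0 * adelicMpCont.twist (Fp L) (Fin (n + n)) (gramDA L e dV hdV dW hdW) sa η g * (rDelta L e dV hdV hdV0 dW hdW hdW0)⁻¹) Φ 0 =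
      c g * (Φ : (Fin (n + n) → AdeleRing (𝓞 (Fp L)) (Fp L)) → ℂ) 0 := by
    intro g hg Φ
    have h : IsSiegelDelta L e dV hdV dW hdW (jA g) := hg
    simp only [c, dif_pos h]
    exact (Classical.choose_spec (horig g h)).1 Φ
  have hcsq : ∀ g ∈ S, c g ^ 2 = τ g ^ 2 := by
    intro g hg
    have h : IsSiegelDelta L e dV hdV dW hdW (jA g) := hg
    simp only [c, τ, dif_pos h]
    exact (Classical.choose_spec (horig g h)).2
  have hS1 : (1 : UnitaryGroup.arch (Fp L) L (IsCMField.complexConj L) (n + n) (hermD L e dV hdV dW hdW)) ∈ S := by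
    show IsSiegelDelta L e dV hdV dW hdW (jA 1)
    rw [map_one]; exact isSiegelDelta_one' L e dV hdV dW hdW
  have hSmul : ∀ p ∈ S, ∀ q ∈ S, p * q ∈ S := by
    intro p hp q hq
    show IsSiegelDelta L e dV hdV dW hdW (jA (p * q))
    rw [map_mul]; exact isSiegelDelta_mul L e dV hdV dW hdW hp hq
  have hc : ∀ p ∈ S, ∀ q ∈ S, c (p * q) = c p * c q := by
    intro p hp q hq
    have h1 := hcval (p * q) (hSmul p hp q hq) Φ₀
    rw [conj_twist_mul, opD_mul] at h1
    have h2 := hcval p hp (adelicMpCont.omega (Fp L) (Fin (n + n)) (gramDA L e dV hdV dW hdW)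
      (rDelta L e dV hdV hdV0 dW hdW hdW0 * adelicMpCont.twist (Fp L) (Fin (n + n)) (gramDA L e dV hdV dW hdW) sa η q *
        (rDelta L e dV hdV hdV0 dW hdW hdW0)⁻¹) Φ₀)
    have h3 := hcval q hq Φ₀
    have h4 : c (p * q) * (Φ₀ : (Fin (n + n) → AdeleRing (𝓞 (Fp L)) (Fp L)) → ℂ) 0 =
        c p * (c q * (Φ₀ : (Fin (n + n) → AdeleRing (𝓞 (Fp L)) (Fp L)) → ℂ) 0) := by
      rw [← h3, ← h1]
      exact h2
    rw [← mul_assoc] at h4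
    exact mul_right_cancel₀ hΦ₀ h4
  have hτ : ∀ p ∈ S, ∀ q ∈ S, τ (p * q) = τ p * τ q :=
    fun p hp q hq => prescribed_mul L e dV hdV dW hdW jA χ hp hq
  have hτ0 : ∀ p ∈ S, τ p ≠ 0 := fun p _ => prescribed_ne_zero L e dV hdV dW hdW jA χ p
  have hgen : ∀ p ∈ S, ∃ l : List (UnitaryGroup.arch (Fp L) L (IsCMField.complexConj L) (n + n) (hermD L e dV hdV dW hdW)), (∀ q ∈ l, q ∈ S) ∧ p = (l.map fun q => q * q).prod :=
    fun p hp => exists_list_sq_of_isSiegelDelta_arch L e dV hdV hdV0 dW hdW hdW0 jA hjA p hp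
  have hcτ := eq_of_sq_eq_of_prod_squares S hS1 hSmul c τ hc hτ hτ0 hcsq hgen
  -- (3) conclusion
  intro g hS _ Φ
  exact (hcval g hS Φ).trans (by rw [hcτ g hS])

include hsa hjA in
/-- **THE ARCHIMEDEAN HALF FROM A FOLLAND-FRAMED SECTION**: for a continuous character `η` of `H(L⁺ ⊗ ℝ)` with
`η(g)² · quot(sW g) = χ(det_Δ (g,1))²` on `P_Δ(L⁺ ⊗ ℝ)`, the twist `sa ⊗ η` of the archimedean lift `sa` of `(eW, sW)`
is an archimedean half of the doubled Weil representation: `IsArchHalf χ (sa ⊗ η)`. [cite: GelbartRogawski1991, §3.1 Prop. 3.1.1 p. 455] -/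
theorem isArchHalf_twist_archLift (χ : HeckeCharacter L) (hcont : Continuous sa) (η : UnitaryGroup.arch (Fp L) L (IsCMField.complexConj L) (n + n) (hermD L e dV hdV dW hdW) →* ℂˣ)
    (hηc : Continuous fun g => ((η g : ℂˣ) : ℂ))
    (hη : ∀ g : UnitaryGroup.arch (Fp L) L (IsCMField.complexConj L) (n + n) (hermD L e dV hdV dW hdW), IsSiegelDelta L e dV hdV dW hdW (jA g) →
      ((η g : ℂˣ) : ℂ) ^ 2 * MpS.quot (sW g) = ((chiDet L e dV hdV dW hdW χ (jA g) : ℂˣ) : ℂ) ^ 2) :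
    IsArchHalf L e dV hdV hdV0 dW hdW hdW0 χ (adelicMpCont.twist (Fp L) (Fin (n + n)) (gramDA L e dV hdV dW hdW) sa η) :=
  isArchHalf_twist L e dV hdV hdV0 dW hdW hdW0 jA hjA eW sW hfin hdict sa hsa χ hcont η hηc
    (parabolicPrescribed_twist L e dV hdV hdV0 dW hdW hdW0 jA hjA eW sW hfin hdict sa hsa χ η hη)

end Parabolic

end Literature.NumberTheory.GelbartRogawski1991.GRConstruction

end

/-! ### Build-lane note (ops-buildfix G11b-3 recipe v2, LEDGER B13-1/B14-5/B14-7, 2026-08-22)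
`lean -o` (the hub build lane, never `lean`/the gate check) runs Lean 4.32's library-suggestion indexers
(`Lean.LibrarySuggestions.SymbolFrequency` / `SineQuaNon`, from their `exportEntriesFn`) over the statement of every local
theorem constant that is not a denied premise; on this family's statements (very large dependent binder telescopes) that fold
runs for tens of minutes (incident G11b-3, run/shared/lean/ops/buildfix/G11b-3-DOSSIER.md). `isDeniedPremise` skips
`[implicit_reducible]` constants before any fold, and the status is inert on theorems (Meta never unfolds `thmInfo`).
v2 form: ONE file-final, top-level `local` attribute — it goes through the synchronous scoped reducibility extension that
`getReducibilityStatusCore` reads first, so it needs no `set_option Elab.async false` (parallel elaboration stays on), also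
reaches auto-realized `*.congr_simp` / structure-projection theorem constants, is never popped before export, and is not
exported. No statement or proof is changed. -/
set_option allowUnsafeReducibility true in
attribute [local implicit_reducible]
  Literature.NumberTheory.GelbartRogawski1991.GRConstruction.smul_adelicTensorEnd_id
  Literature.NumberTheory.GelbartRogawski1991.GRConstruction.isArch_twist
  Literature.NumberTheory.GelbartRogawski1991.GRConstruction.isArchHalf_twist
  Literature.NumberTheory.GelbartRogawski1991.GRConstruction.conj_mul_general
  Literature.NumberTheory.GelbartRogawski1991.GRConstruction.conj_central_general
  Literature.NumberTheory.GelbartRogawski1991.GRConstruction.conj_twist_mul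
  Literature.NumberTheory.GelbartRogawski1991.GRConstruction.conj_twist_eq
  Literature.NumberTheory.GelbartRogawski1991.GRConstruction.modDelta_ne_zero
  Literature.NumberTheory.GelbartRogawski1991.GRConstruction.prescribed_mul
  Literature.NumberTheory.GelbartRogawski1991.GRConstruction.prescribed_ne_zero
  Literature.NumberTheory.GelbartRogawski1991.GRConstruction.det_yBlock_pos_and_eq_modDelta_sq
  Literature.NumberTheory.GelbartRogawski1991.GRConstruction.exists_list_sq_of_isSiegelDelta_arch
  Literature.NumberTheory.GelbartRogawski1991.GRConstruction.eq_of_sq_eq_of_prod_squares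
  Literature.NumberTheory.GelbartRogawski1991.GRConstruction.exists_originValue_sq
  Literature.NumberTheory.GelbartRogawski1991.GRConstruction.parabolicPrescribed_twist
  Literature.NumberTheory.GelbartRogawski1991.GRConstruction.isArchHalf_twist_archLift
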